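import Summits.BirchSwinnertonDyer.BirchSwinnertonDyer.Theorems.CongruentShaFreeCutBDPWaldspurgerFormula
import Summits.BirchSwinnertonDyer.BirchSwinnertonDyer.Theorems.CongruentShaFreeCutTwoAdicBDPExistsValueUpToResidual
import HarnessLib

set_option linter.dupNamespace false -- `Summit.BirchSwinnertonDyer.BirchSwinnertonDyer.Theorems.…` (summit = sub)
set_option autoImplicit false

/-!
# Route `CongruentShaFreeCut` (rung S2) — KERNEL CENSUS of the BDP road with ONE NAMED `Prop` PER HALF:
# `T ⟸ {(res) at 2, (LB-exist♯), BDPWaldspurgerFormulaUpTo 2, (LB-wan♯)} + six refereed facts`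

Cell `bsd-cn100`, prover seat `bsd-cn100-transfer` (g11), plan g15 RULING-3 (e2) «so the research frontier of
19079 is ONE NAMED Prop per half». Supports, does not close, stmt-BirchSwinnertonDyer-19079. THEOREMS ONLY; imports
no `Theses` module directly. PARTITION: none — RANK axis. HONEST FRAMING: conditional compositions; the four
research inputs are OPEN ((LB-exist♯) a construction at the additive prime `2`; `BDPWaldspurgerFormulaUpTo 2` the
generalised `p`-adic Waldspurger formula at `2 ∣ N`; (LB-wan♯) the main-conjecture divisibility; (res) the
Selmer-only residual); neither the congruent number problem nor BSD is touched.

* `cruxA_of_res_of_exists_of_waldspurger_of_wan` — crux A `RankPosOfTwoSelmerCorankOne`;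
* `cruxB_of_exists_of_waldspurger_of_wan` — crux B `AnalyticRankOneOfRankOneFiniteShaTwo`;
* **`leaf_of_res_of_exists_of_waldspurger_of_wan`** — the rung-S2 leaf `T = rankOne_twoConverse_congruentNumber`
  (ONE binder, never split) from {(res), (LB-exist♯), `BDPWaldspurgerFormulaUpTo 2`, (LB-wan♯)} + the six
  refereed facts; the ∀-tuple quantifiers inside the value and divisibility names are honest (LEMMA R,
  LEMMA R∞: one tuple each).

References: [CastellaGrossiLeeSkinner2022] §5.2; [BertoliniDarmonPrasanna2013] Thm. 5.13; [GrossZagier1986]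
Thm. I.6.3; [Skinner2020] Thm. B (shapes; nothing asserted).
-/

noncomputable section

open scoped Classical

open PowerSeries WeierstrassCurve NumberField IsDedekindDomain Field Literature.NumberTheory.EllipticCurves
  Literature.NumberTheory.EllipticCurves.ModularForms Literature.NumberTheory.QuadraticFields
  Literature.NumberTheory.EllipticCurves.Castella2018
open Literature.NumberTheory.GaloisRepresentations Literature.NumberTheory.GaloisCohomology
open Summit.BirchSwinnertonDyer.BirchSwinnertonDyer.Theses.CongruentShaFreeCut
open Summit.BirchSwinnertonDyer.BirchSwinnertonDyer.Theorems.CongruentShaFreeCutTwoAdicBDPTripleUpTo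
  (TwoAdicBDPElementExistsUpTo TwoAdicWanDivisibilityUpTo)
open Summit.BirchSwinnertonDyer.BirchSwinnertonDyer.Theorems.CongruentShaFreeCutTwoAdicBDPExistsValueUpTo
open Summit.BirchSwinnertonDyer.BirchSwinnertonDyer.Theorems.CongruentShaFreeCutBDPWaldspurgerFormula

namespace Summit.BirchSwinnertonDyer.BirchSwinnertonDyer.Theorems.CongruentShaFreeCutBDPWaldspurgerCensus

/-- **Crux A ⟸ (res) + (LB-exist♯) + `BDPWaldspurgerFormulaUpTo 2` + (LB-wan♯) + five refereed facts**
(`cruxA_of_res_of_bdpExistsValueUpTo` ∘ `bdpExistsWithValueUpTo_of_exists_of_waldspurger`). CONDITIONAL;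
closes nothing. [cite: CastellaGrossiLeeSkinner2022, §5.2 (proof of Thm. 5.2.1)] [cite: Skinner2020, Thm. B (shape)] -/
theorem cruxA_of_res_of_exists_of_waldspurger_of_wan
    (hpar : ∀ (W : WeierstrassCurve ℚ) [W.IsElliptic] (p : ℕ) [Fact p.Prime], p_parity W p)
    (hmod : ModularForms.exists_isNewformOf) (hHL : HoffsteinLuo1997_exists_twist_L_one_ne_zero)
    (hKato : ∀ (W : WeierstrassCurve ℚ) [W.IsElliptic] (p : ℕ) [Fact p.Prime],
      kato_finite_of_L_one_ne_zero W p)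
    (hHP : ∀ (W : WeierstrassCurve ℚ) (K : Type) [Field K] [NumberField K],
      exists_isHeegnerPoint W K)
    (hres : ∀ ⦃n : ℕ⦄, Squarefree n → ∀ (K : Type) [Field K] [NumberField K],
      IsImaginaryQuadratic K → SatisfiesHeegnerHypothesis 2 K →
        ((congruentNumberCurve n).baseChange K).selmerCorank 2 = 1 →
      ∀ (w : HeightOneSpectrum (𝓞 K)), ((2 : ℕ) : 𝓞 K) ∈ w.asIdeal →
        Finite ↥(((congruentNumberCurve n).baseChange K).selmerGroupPInfty 2 ⊓
          selmerLocalKerPrimaryTorsion ((congruentNumberCurve n).baseChange K) (w.adicCompletion K) 2))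
    (hE : TwoAdicBDPElementExistsUpTo) (hW : BDPWaldspurgerFormulaUpTo 2)
    (hWan : TwoAdicWanDivisibilityUpTo) : RankPosOfTwoSelmerCorankOne :=
  cruxA_of_res_of_bdpExistsValueUpTo hpar hmod hHL hKato hHP hres
    (bdpExistsWithValueUpTo_of_exists_of_waldspurger hE hW) hWan

/-- **Crux B ⟸ (LB-exist♯) + `BDPWaldspurgerFormulaUpTo 2` + (LB-wan♯) + six refereed facts**
(`cruxB_of_bdpExistsValueUpTo` ∘ `bdpExistsWithValueUpTo_of_exists_of_waldspurger`). CONDITIONAL; closes nothing.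
[cite: CastellaGrossiLeeSkinner2022, §5.2 (proof of Thm. 5.2.1)] [cite: GrossZagier1986, Thm. I.6.3 with V.§2] -/
theorem cruxB_of_exists_of_waldspurger_of_wan
    (hpar : ∀ (W : WeierstrassCurve ℚ) [W.IsElliptic] (p : ℕ) [Fact p.Prime], p_parity W p)
    (hmod : ModularForms.exists_isNewformOf) (hHL : HoffsteinLuo1997_exists_twist_L_one_ne_zero)
    (hKato : ∀ (W : WeierstrassCurve ℚ) [W.IsElliptic] (p : ℕ) [Fact p.Prime],
      kato_finite_of_L_one_ne_zero W p)
    (hHP : ∀ (W : WeierstrassCurve ℚ) (K : Type) [Field K] [NumberField K],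
      exists_isHeegnerPoint W K)
    (hGZ : ∀ (W : WeierstrassCurve ℚ) (N : ℕ) [NeZero N] (K : Type) [Field K] [NumberField K],
      analyticRankEK_eq_one_iff_heegner_nonTorsion W N K)
    (hE : TwoAdicBDPElementExistsUpTo) (hW : BDPWaldspurgerFormulaUpTo 2)
    (hWan : TwoAdicWanDivisibilityUpTo) : AnalyticRankOneOfRankOneFiniteShaTwo :=
  cruxB_of_bdpExistsValueUpTo hpar hmod hHL hKato hHP hGZ
    (bdpExistsWithValueUpTo_of_exists_of_waldspurger hE hW) hWan

/-- **KERNEL CENSUS OF THE BDP ROAD, ONE NAMED `Prop` PER HALF: the rung-S2 leaf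
`T = rankOne_twoConverse_congruentNumber` ⟸ {(res) at `2`, (LB-exist♯) `TwoAdicBDPElementExistsUpTo`,
`BDPWaldspurgerFormulaUpTo 2`, (LB-wan♯) `TwoAdicWanDivisibilityUpTo`} + the six refereed facts** — the route's
Assembly on the two compositions above (`leaf_of_res_of_bdpExistsValueUpTo` with the ∃∧ statement supplied by
`bdpExistsWithValueUpTo_of_exists_of_waldspurger`). The ∀-tuple quantifiers inside the value name and the
divisibility name cost one tuple each (LEMMA R `…BDPUpToRigidityUnconditional`, LEMMA R∞
`…BDPUpToSeriesRigidity`). CONDITIONAL; neither the congruent number problem nor any case of BSD is touched.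
[cite: GrossZagier1986, Thm. I.6.3 with V.§2] [cite: CastellaGrossiLeeSkinner2022, §5.2 (proof of Thm. 5.2.1)]
[cite: Skinner2020, Thm. B (shape)] -/
theorem leaf_of_res_of_exists_of_waldspurger_of_wan
    (hpar : ∀ (W : WeierstrassCurve ℚ) [W.IsElliptic] (p : ℕ) [Fact p.Prime], p_parity W p)
    (hmod : ModularForms.exists_isNewformOf) (hHL : HoffsteinLuo1997_exists_twist_L_one_ne_zero)
    (hKato : ∀ (W : WeierstrassCurve ℚ) [W.IsElliptic] (p : ℕ) [Fact p.Prime],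
      kato_finite_of_L_one_ne_zero W p)
    (hHP : ∀ (W : WeierstrassCurve ℚ) (K : Type) [Field K] [NumberField K],
      exists_isHeegnerPoint W K)
    (hGZ : ∀ (W : WeierstrassCurve ℚ) (N : ℕ) [NeZero N] (K : Type) [Field K] [NumberField K],
      analyticRankEK_eq_one_iff_heegner_nonTorsion W N K)
    (hres : ∀ ⦃n : ℕ⦄, Squarefree n → ∀ (K : Type) [Field K] [NumberField K],
      IsImaginaryQuadratic K → SatisfiesHeegnerHypothesis 2 K →
        ((congruentNumberCurve n).baseChange K).selmerCorank 2 = 1 →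
      ∀ (w : HeightOneSpectrum (𝓞 K)), ((2 : ℕ) : 𝓞 K) ∈ w.asIdeal →
        Finite ↥(((congruentNumberCurve n).baseChange K).selmerGroupPInfty 2 ⊓
          selmerLocalKerPrimaryTorsion ((congruentNumberCurve n).baseChange K) (w.adicCompletion K) 2))
    (hE : TwoAdicBDPElementExistsUpTo) (hW : BDPWaldspurgerFormulaUpTo 2)
    (hWan : TwoAdicWanDivisibilityUpTo) : rankOne_twoConverse_congruentNumber :=
  leaf_of_res_of_bdpExistsValueUpTo hpar hmod hHL hKato hHP hGZ hres
    (bdpExistsWithValueUpTo_of_exists_of_waldspurger hE hW) hWan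

end Summit.BirchSwinnertonDyer.BirchSwinnertonDyer.Theorems.CongruentShaFreeCutBDPWaldspurgerCensus

end
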